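/-
Copyright (c) 2026 the pub-hodgecm-mathlib formalisation cell (harness21).  Prover seat hodgecm-mathlib-F0P2-p02 (g25); G-rows dealer ∕ reader F0P3a-p09 (g13) (LEAD F0P3a-plan
T14-67 rule 20 ∕ T14-69 (1)); G-ROW LEDGER v3 row (G1)-RAM-TAME part (ii) «P2-RAM» (DEAL 23:19:04Z, triggered on ★ p852963), spec = CENSUS «(G2)∕(G1)-RAM» v1 54c621b9 (F0P2-p02 (g24))
§1, §3; 2026-09-02∕03.  The transitivity-binder ∕ tame-ramified twin of ★ `UnitaryLatticeTreePeriodRelation` (LH6-p03 (g8), p852963), re-lettered row by row; that file's §1 is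
reused BY NAME (imported), nothing of it is restated under its own name.
-/
import Literature.NumberTheory.Automorphic.UnitaryLatticeTreePeriodRelation          -- ★ P2 (LH6-p03, p852963): §1 `mapGL_latt_apartment_{selfDual,two}_of_diagonal` reused BY NAME; brings ★ P1 `…PeriodTransfer` (`natCard_quotient_orbitRel_fixedBy_{glInt,conj_glInt,inf}_eq_rankN`), ★ `…ApartmentAction`∕`…ApartmentPath` ED. 2 (`…_translate_of_isVertex`, `…adj_apartment_*_of_isVertex`, `latt_diagonal_le_latt_diagonal_iff`, `v_zpow_le_v_zpow_iff`), ★ `…Star`, ★ `TreeActionLinePerPeriod`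
import Literature.NumberTheory.Automorphic.UnitaryLatticeTreeEulerRelationRamified    -- ★ (LH5-p04): `forall_flag_exists_unitary_of_v_two` ((I) for any involution with `|2| = 1`); brings ★ `…FramesOfInvolution` (`isTree_latticeGraph_three_of_transitive`, ★ `…TypeTwoTransitiveRamified`, ★ `…SelfDualTransitiveTame`), ★ `…RootStarOrbitOfInvolution` (★ `…StarOfInvolution`), ★ `…ApartmentOfInvolution`
import HarnessLib

/-!
# Kottwitz's NON-ELLIPTIC relation per period on the `U(3)` lattice tree for ANY valuation-preserving involution, given the three transitivities — and at a TAME RAMIFIED place: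
# `#(Fix_γ(U⧸K₀)∕τ^ℤ) + #(Fix_γ(U⧸K₁)∕τ^ℤ) = #(Fix_γ(U⧸(K₀ ⊓ K₁))∕τ^ℤ)` for a DIAGONAL `γ` and the unitary translation `τ = diag(ϖ⁻¹, 1, σϖ)` (Kottwitz 1988 §2 Thm. 2; Serre, *Trees* I.6.4)

Topic `NumberTheory/Automorphic`; namespace `Literature.NumberTheory.Automorphic.UnitaryLatticeTree`.  THEOREMS ONLY (no definition ∕ instance ∕ notation ∕ named fact ∕ `sorry`).
Cell `pub/hodgecm-mathlib`, crux H413 = `stmt-HodgeConjecture-24833` (`--supports` lane, helper), LH6 rung-0 residue, CENSUS «EP-G» v1 (F0P3a-p09) §5 brick (G1) «(N)-G», its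
ramified column = CENSUS «(G2)∕(G1)-RAM» v1 (F0P2-p02 (g24)) §3 «(G1)-RAM»: the COSET-SIDE relation of ★ `UnitaryLatticeTreePeriodRelation` (P2, `UnramifiedLocalConjDatum σ ϖ`,
`τ = diag(ϖ⁻¹, 1, ϖ)`) carried to (§1) ANY involution `σ` preserving `v`, with the three transitivities (A) self-dual vertices, (B) type-two vertices, (I) flags as BINDERS (the currency
of ★ P1 `UnitaryLatticeTreePeriodTransfer`) and the translation `τ` read with THIRD SLOT `σϖ` — `diag(ϖ⁻¹, 1, σϖ) ∈ U(σ, J₀)` since `σ(ϖ⁻¹)·σϖ = 1` —, and (§2) the TAME RAMIFIED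
place (`σϖ = −ϖ`, `|2| = 1`, `σ` residually trivial, first-order norm surjectivity: the binder block of ★ `isTree_latticeGraph_three_of_neg`, VERBATIM), where (A)(B)(I) are ★
(`exists_unitary_mapGL_stdLattice_eq_of_isSelfDualLattice_of_v_two`, `forall_isVertexLattice_two_exists_mapGL_N₁_eq_of_neg`, `forall_flag_exists_unitary_of_v_two`) and
`τ = diag(ϖ⁻¹, 1, −ϖ)`.  At `σϖ = ϖ` §1 specialises to ★ P2's theorem (not restated).  Seat F0P2-p02 (g25).  HONEST LABEL: count-neutral orbit counting (nothing printed is asserted;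
it widens the EP-G column's (N) relation to tame ramified places, instances only at t1′; WILD ∕ dyadic ramified places stay OPEN at the transitivity level, census §4); HC_CM is proved
only modulo the 7 printed citations (2 remaining named inputs hLiu418 = stmt-HodgeConjecture-24832, h413 = stmt-HodgeConjecture-24833) until rung 0 closes.

THE THEOREMS.  `K` a field with `Valued K ℤᵐ⁰` and the compatible `ValuativeRel`, `σ` an involution with `|σ x| = |x|`, `|ϖ| = exp(−1)`, `J₀ = antidiag(1,1,1)`, `U = U(σ, J₀)`,
`g₁ = diag(1,1,ϖ)` (`N₁ = g₁·𝒪³` the base type-two vertex), a MODEL `eU : G ≃* U` with levels `CA, CB, CI ≤ G` given by membership (`CA ↔ GL₃(𝒪)`, `CB ↔ g₁ GL₃(𝒪) g₁⁻¹`, `CI ↔` both —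
`K₀, K₁, K₀ ⊓ K₁` of ★ `UnitaryLatticeTreeFixedCosetFlags`), `τ ∈ G` with `eU τ = diag(ϖ⁻¹, 1, σϖ)` (it translates the apartment `… L_a — L′_a — L_{a−1} — …`,
`L_a = latt diag(ϖ^a, 1, ϖ^{−a})`, `L′_a = latt diag(ϖ^a, 1, ϖ^{1−a})` — vertices for ANY such `σ`, ★ `…_latt_diagonal_zpow_of_v` — by TWO edges, ★ `latticeGraphIso_apartment_*_translate_of_isVertex`
at `c = −1`), `γ ∈ G` with `eU γ` DIAGONAL of valuation profile `(|ϖ^c|, 1, |ϖ^{−c}|)`, `τγ = γτ`, per-period fixed-coset counts at `CA`, `CB` finite.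
* §1 **`natCard_quotient_fixedBy_add_eq_natCard_quotient_fixedBy_inf_three_of_transitive`** — binders `hA` (every self-dual vertex is `u·L₀`), `hB` (every type-two vertex is
  `u·N₁`), `hI` (every flag is `(u·L₀, u·N₁)`): `#(Fix_γ(G⧸CA)∕τ^ℤ) + #(Fix_γ(G⧸CB)∕τ^ℤ) = #(Fix_γ(G⧸CI)∕τ^ℤ)` in the `orbitRel (zpowers ⟨τ, _⟩) ∕ fixedBy (G ⧸ C) γ` currency of ★ P2
  (conclusion TOKEN FOR TOKEN).  The tree is ★ `isTree_latticeGraph_three_of_transitive hA hB`.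
* §2 **`natCard_quotient_fixedBy_add_eq_natCard_quotient_fixedBy_inf_three_of_neg`** — the tame ramified block `(hσ) (hvσ) (hϖ) (hσϖ : σ ϖ = −ϖ) (hres) (h2 : |2| = 1) (hnorm)`
  replaces the three binders.
PROOF of §1 = ★ P2's, re-lettered row by row (census §1∕§3): COSET → TREE per level (★ P1, datum-free); tree ★ `isTree_latticeGraph_three_of_transitive`; root ★
`isSelfDualLattice_stdLattice_three_of_v`; types ★ `type_of_lt_three` ∕ ★ `not_isSelfDualLattice_of_isVertexLattice_two_of_v`; `N₁` ★ `isVertexLattice_two_N₁_of_v` + ★ `mapGL_N₁_lt_stdLattice_of_v`;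
apartment vertices ★ `isSelfDualLattice_latt_diagonal_zpow_of_v` ∕ ★ `isVertexLattice_two_latt_diagonal_zpow_of_v`, edges ★ `latticeGraph_adj_apartment_*_of_isVertex`, translation ★
`latticeGraphIso_apartment_*_translate_of_isVertex` (matrix `diag(ϖ^{−1}, 1, (σϖ)^{−(−1)})`), shift by `γ` ★ P2 §1 `mapGL_latt_apartment_*_of_diagonal`; the two-step line, «fixed vertices
= pointwise-fixed edges» per period and the union ∕ flag ↔ edge counts VERBATIM (★ `TreeActionLinePerPeriod`, ★ `OrbitQuotientTubeCount`).

## References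
* [Kottwitz1988] R. E. Kottwitz, *Tamagawa numbers*, Ann. of Math. 127 (1988), 629–646, §2 Theorem 2 (non-elliptic case).
* [Serre1980Trees] J.-P. Serre, *Trees* (1980), Ch. I §6.4 Prop. 24–25 (hyperbolic automorphisms, axis), Ch. II §1.1.
* [Laumon1995] G. Laumon, *Cohomology of Drinfeld Modular Varieties* I (1996), Lemma (5.3.2).
* [BruhatTits1972] F. Bruhat, J. Tits, *Groupes réductifs sur un corps local I*, Publ. IHÉS 41 (1972), §10 (the apartment of a maximal split torus of a unitary group).
* [Tits1979] J. Tits, *Reductive groups over local fields*, PSPM 33.1 (1979), §2.4, §3.5 (the ramified quasi-split `²A₂`: local index, both vertices special).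
-/

set_option autoImplicit false

noncomputable section

open Matrix MulAction SimpleGraph Literature.NumberTheory.Automorphic Literature.Combinatorics.SimpleGraph Literature.GroupTheory
open Literature.NumberTheory.Automorphic.HermitianLattice Literature.NumberTheory.Automorphic.UnitaryGroup Literature.NumberTheory.Automorphic.CartanUnique
open scoped Matrix MatrixGroups WithZero Valued Pointwise

namespace Literature.NumberTheory.Automorphic.UnitaryLatticeTree

variable {K : Type*} [Field K] [Valued K ℤᵐ⁰] [ValuativeRel K] [(Valued.v : Valuation K ℤᵐ⁰).Compatible]

/-! ## §1 The per-period relation on the `U(3)` tree of any valuation-preserving involution, given the three transitivities -/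

section Transitive

variable {σ : K →+* K} {ϖ : K}

/-- **KOTTWITZ'S NON-ELLIPTIC RELATION PER PERIOD ON THE `U(3)` TREE, ANY VALUATION-PRESERVING INVOLUTION `σ`, TRANSITIVITIES AS BINDERS, ON ANY MODEL `eU : G ≃* U(σ, J₀)`.**
`hσ : σ² = 1`, `hvσ : |σ·| = |·|`, `hϖ : |ϖ| = exp(−1)`; `g₁ = diag(1,1,ϖ)`; (A) `hA`: every self-dual vertex is `u·L₀`, (B) `hB`: every type-two vertex is `(u g₁)·L₀ = u·N₁`, (I) `hI`:
every flag `M < L` (`L` self-dual, `M` of type two) is `(u·L₀, u·N₁)` — `u ∈ U(σ, J₀)`; levels `CA, CB, CI ≤ G` by MEMBERSHIP through `eU` (`GL₃(𝒪)`, `g₁ GL₃(𝒪) g₁⁻¹`, both);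
`τ ∈ G` with `eU τ = diag(ϖ⁻¹, 1, σϖ)`, `γ ∈ G` with `eU γ` diagonal of valuation profile `(|ϖ^c|, 1, |ϖ^{−c}|)`, `τγ = γτ`; the per-period fixed-coset counts at `CA` and `CB` finite.
Then `#(Fix_γ(G⧸CA)∕τ^ℤ) + #(Fix_γ(G⧸CB)∕τ^ℤ) = #(Fix_γ(G⧸CI)∕τ^ℤ)` — the conclusion of ★ `natCard_quotient_fixedBy_add_eq_natCard_quotient_fixedBy_inf_three` token for token
(that theorem is the case `σϖ = ϖ` with (A)(B)(I) discharged by the unramified datum; §2 below is the tame ramified case).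
[cite: Kottwitz1988, §2 Theorem 2] [cite: Serre1980Trees, I.6.4 Prop. 24–25; II.1.1] [cite: Laumon1995, Lemma (5.3.2)] [cite: BruhatTits1972, §10] [cite: Tits1979, §2.4, §3.5] -/
theorem natCard_quotient_fixedBy_add_eq_natCard_quotient_fixedBy_inf_three_of_transitive
    (hσ : ∀ x, σ (σ x) = x) (hvσ : ∀ a, Valued.v (σ a) = Valued.v a) (hϖ : Valued.v ϖ = WithZero.exp (-1 : ℤ))
    (g₁ : GL (Fin 3) K) (hg₁ : (g₁ : Matrix (Fin 3) (Fin 3) K) = Matrix.diagonal ![(1 : K), 1, ϖ])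
    (hA : ∀ M : Submodule (Valued.integer K) (Fin 3 → K), IsSelfDualLattice σ ϖ ((StdForm.antidiagonal 3).over K) M →
      ∃ u : ↥(unitaryGroupOfForm σ ((StdForm.antidiagonal 3).over K)), mapGL (u : GL (Fin 3) K) (stdLattice K 3) = M)
    (hB : ∀ M : Submodule (Valued.integer K) (Fin 3 → K), IsVertexLattice σ ϖ ((StdForm.antidiagonal 3).over K) 2 M →
      ∃ u : ↥(unitaryGroupOfForm σ ((StdForm.antidiagonal 3).over K)), mapGL ((u : GL (Fin 3) K) * g₁) (stdLattice K 3) = M)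
    (hI : ∀ L M : Submodule (Valued.integer K) (Fin 3 → K), IsSelfDualLattice σ ϖ ((StdForm.antidiagonal 3).over K) L →
      IsVertexLattice σ ϖ ((StdForm.antidiagonal 3).over K) 2 M → M < L →
      ∃ u : ↥(unitaryGroupOfForm σ ((StdForm.antidiagonal 3).over K)), mapGL (u : GL (Fin 3) K) (stdLattice K 3) = L ∧ mapGL ((u : GL (Fin 3) K) * g₁) (stdLattice K 3) = M)
    {G : Type*} [Group G] (eU : G ≃* ↥(unitaryGroupOfForm σ ((StdForm.antidiagonal 3).over K))) (CA CB CI : Subgroup G)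
    (hCA : ∀ g : G, g ∈ CA ↔ ((eU g : ↥(unitaryGroupOfForm σ ((StdForm.antidiagonal 3).over K))) : GL (Fin 3) K) ∈ glInt 3 K)
    (hCB : ∀ g : G, g ∈ CB ↔ ((eU g : ↥(unitaryGroupOfForm σ ((StdForm.antidiagonal 3).over K))) : GL (Fin 3) K) ∈ (glInt 3 K).map (MulAut.conj g₁).toMonoidHom)
    (hCI : ∀ g : G, g ∈ CI ↔ ((eU g : ↥(unitaryGroupOfForm σ ((StdForm.antidiagonal 3).over K))) : GL (Fin 3) K) ∈ glInt 3 K ∧ ((eU g : ↥(unitaryGroupOfForm σ ((StdForm.antidiagonal 3).over K))) : GL (Fin 3) K) ∈ (glInt 3 K).map (MulAut.conj g₁).toMonoidHom)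
    (τ γ : G) (hτm : (((eU τ : ↥(unitaryGroupOfForm σ ((StdForm.antidiagonal 3).over K))) : GL (Fin 3) K) : Matrix (Fin 3) (Fin 3) K) = Matrix.diagonal ![ϖ⁻¹, 1, σ ϖ])
    {e : Fin 3 → K} (hγm : (((eU γ : ↥(unitaryGroupOfForm σ ((StdForm.antidiagonal 3).over K))) : GL (Fin 3) K) : Matrix (Fin 3) (Fin 3) K) = Matrix.diagonal e) {c : ℤ}
    (he₀ : Valued.v (e 0) = Valued.v (ϖ ^ c)) (he₁ : Valued.v (e 1) = 1) (he₂ : Valued.v (e 2) = Valued.v (ϖ ^ (-c))) (hτγ : τ * γ = γ * τ)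
    (hfinA : Finite (Quotient ((orbitRel (Subgroup.zpowers (⟨τ, Subgroup.mem_centralizer_singleton_iff.2 hτγ⟩ : Subgroup.centralizer ({γ} : Set G))) (G ⧸ CA)).comap
        (Subtype.val : ↥(fixedBy (G ⧸ CA) γ) → G ⧸ CA))))
    (hfinB : Finite (Quotient ((orbitRel (Subgroup.zpowers (⟨τ, Subgroup.mem_centralizer_singleton_iff.2 hτγ⟩ : Subgroup.centralizer ({γ} : Set G))) (G ⧸ CB)).comap
        (Subtype.val : ↥(fixedBy (G ⧸ CB) γ) → G ⧸ CB)))) :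
    Nat.card (Quotient ((orbitRel (Subgroup.zpowers (⟨τ, Subgroup.mem_centralizer_singleton_iff.2 hτγ⟩ : Subgroup.centralizer ({γ} : Set G))) (G ⧸ CA)).comap
        (Subtype.val : ↥(fixedBy (G ⧸ CA) γ) → G ⧸ CA))) +
      Nat.card (Quotient ((orbitRel (Subgroup.zpowers (⟨τ, Subgroup.mem_centralizer_singleton_iff.2 hτγ⟩ : Subgroup.centralizer ({γ} : Set G))) (G ⧸ CB)).comap
        (Subtype.val : ↥(fixedBy (G ⧸ CB) γ) → G ⧸ CB))) =
    Nat.card (Quotient ((orbitRel (Subgroup.zpowers (⟨τ, Subgroup.mem_centralizer_singleton_iff.2 hτγ⟩ : Subgroup.centralizer ({γ} : Set G))) (G ⧸ CI)).comap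
        (Subtype.val : ↥(fixedBy (G ⧸ CI) γ) → G ⧸ CI))) := by
  classical
  have hϖ0 : ϖ ≠ 0 := uniformizer_ne_zero hϖ
  have hϖ1 : Valued.v ϖ ≤ 1 := uniformizer_mem_integer hϖ
  -- the root, the base edge, the types (datum-free ★ `_of_v` twins, as in ★ `UnitaryLatticeTreeEulerRelationRamified`)
  have hroot : IsSelfDualLattice σ ϖ ((StdForm.antidiagonal 3).over K) (stdLattice K 3) := isSelfDualLattice_stdLattice_three_of_v hϖ
  have hnot : ∀ M : Submodule (Valued.integer K) (Fin 3 → K), IsVertexLattice σ ϖ ((StdForm.antidiagonal 3).over K) 2 M →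
      ¬ IsSelfDualLattice σ ϖ ((StdForm.antidiagonal 3).over K) M := fun M h2 => not_isSelfDualLattice_of_isVertexLattice_two_of_v hvσ hϖ h2
  have hN₁ : mapGL g₁ (stdLattice K 3) = latt (Matrix.diagonal ![(1 : K), 1, ϖ]) := by rw [← hg₁]; rfl
  have hg₁2 : IsVertexLattice σ ϖ ((StdForm.antidiagonal 3).over K) 2 (mapGL g₁ (stdLattice K 3)) := by
    rw [hN₁]; exact isVertexLattice_two_N₁_of_v hvσ hϖ1 hϖ0
  have hlt₁ : mapGL g₁ (stdLattice K 3) < stdLattice K 3 := by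
    have h := mapGL_N₁_lt_stdLattice_of_v hvσ hϖ (isVertexLattice_two_N₁_of_v hvσ hϖ1 hϖ0) (Subgroup.one_mem (unitaryInt σ ((StdForm.antidiagonal 3).over K)))
    rwa [Subgroup.coe_one, mapGL_one, ← hN₁] at h
  -- the tree, from (A) and (B) alone (★ `isTree_latticeGraph_three_of_transitive`)
  have hT : (latticeGraph σ ϖ ((StdForm.antidiagonal 3).over K)).IsTree :=
    isTree_latticeGraph_three_of_transitive hσ hvσ hϖ
      (fun L hL => by obtain ⟨u, hu⟩ := hA L hL; exact ⟨u, hu.symm⟩)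
      (fun M hM => by obtain ⟨u, hu⟩ := hB M hM; exact ⟨u, by rw [← hu, mapGL_mul, hN₁]⟩)
  -- COSET → TREE, level by level (★ P1)
  obtain ⟨hAeq, hAfin⟩ := natCard_quotient_orbitRel_fixedBy_glInt_eq_rankN σ ϖ _ eU hroot hA CA hCA γ τ hτγ
  obtain ⟨hBeq, hBfin⟩ := natCard_quotient_orbitRel_fixedBy_conj_glInt_eq_rankN σ ϖ _ eU hg₁2 hB CB hCB γ τ hτγ
  obtain ⟨hIeq, -⟩ := natCard_quotient_orbitRel_fixedBy_inf_eq_rankN σ ϖ _ eU hroot hg₁2 hlt₁ hI CI hCI γ τ hτγ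
  have hτγ' : eU τ * eU γ = eU γ * eU τ := by rw [← map_mul, hτγ, map_mul]
  rw [hAeq, hBeq, hIeq]
  have hfinA' := hAfin.1 hfinA
  have hfinB' := hBfin.1 hfinB
  clear hAeq hBeq hIeq hAfin hBfin
  /- THE TREE SIDE (★ P2 verbatim).  Notation: `V` the vertices, `pτ`, `pγ` the permutations, `Φ = ⟨pτ⟩`. -/
  set V := {M : Submodule (Valued.integer K) (Fin 3 → K) // IsVertex σ ϖ ((StdForm.antidiagonal 3).over K) M} with hV
  set pτ : Equiv.Perm V := latticeGraphPerm σ ϖ ((StdForm.antidiagonal 3).over K) (eU τ) with hpτ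
  set pγ : Equiv.Perm V := latticeGraphPerm σ ϖ ((StdForm.antidiagonal 3).over K) (eU γ) with hpγ
  set Φ : Subgroup (Equiv.Perm V) := Subgroup.zpowers pτ with hΦ
  let τΦ : ↥Φ := ⟨pτ, Subgroup.mem_zpowers pτ⟩
  have hτΦcoe : ∀ n : ℤ, ((τΦ ^ n : ↥Φ) : Equiv.Perm V) = pτ ^ n := fun n => by rw [SubgroupClass.coe_zpow]
  have hgen : ∀ φ : ↥Φ, ∃ n : ℤ, τΦ ^ n = φ := fun φ => by
    obtain ⟨n, hn⟩ := Subgroup.mem_zpowers_iff.1 φ.2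
    exact ⟨n, Subtype.ext (by rw [hτΦcoe, hn])⟩
  have hΦsmul : ∀ (φ : ↥Φ) (v : V), φ • v = (φ : Equiv.Perm V) v := fun _ _ => rfl
  have hpow : ∀ (n : ℤ) (v : V), (τΦ ^ n) • v = latticeGraphPerm σ ϖ ((StdForm.antidiagonal 3).over K) (eU τ ^ n) v := fun n v => by
    rw [hΦsmul, hτΦcoe, hpτ, ← latticeGraphPerm_zpow]
  have hexp : ∀ φ : ↥Φ, ∃ n : ℤ, ∀ v : V, φ • v = latticeGraphPerm σ ϖ ((StdForm.antidiagonal 3).over K) (eU τ ^ n) v := fun φ => by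
    obtain ⟨n, rfl⟩ := hgen φ
    exact ⟨n, hpow n⟩
  have hadjΦ : ∀ (φ : ↥Φ) (a b : V), (latticeGraph σ ϖ ((StdForm.antidiagonal 3).over K)).Adj (φ • a) (φ • b) ↔
      (latticeGraph σ ϖ ((StdForm.antidiagonal 3).over K)).Adj a b := fun φ a b => by
    obtain ⟨n, hn⟩ := hexp φ
    rw [hn, hn]
    exact (latticeGraphIso σ ϖ ((StdForm.antidiagonal 3).over K) (eU τ ^ n)).map_rel_iff
  have hγadj : ∀ a b : V, (latticeGraph σ ϖ ((StdForm.antidiagonal 3).over K)).Adj (pγ a) (pγ b) ↔ (latticeGraph σ ϖ ((StdForm.antidiagonal 3).over K)).Adj a b :=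
    fun a b => (latticeGraphIso σ ϖ ((StdForm.antidiagonal 3).over K) (eU γ)).map_rel_iff
  -- `Φ` preserves types and commutes with `pγ`
  have hΦtype : ∀ (φ : ↥Φ) (v : V) (d : ℕ), IsVertexLattice σ ϖ ((StdForm.antidiagonal 3).over K) d (φ • v).1 ↔ IsVertexLattice σ ϖ ((StdForm.antidiagonal 3).over K) d v.1 :=
    fun φ v d => by
    obtain ⟨n, hn⟩ := hexp φ
    rw [hn, latticeGraphPerm_apply_coe]
    exact isVertexLattice_mapGL_iff σ ϖ _ (eU τ ^ n) v.1
  have hΦcomm : ∀ (φ : ↥Φ) (v : V), pγ (φ • v) = φ • pγ v := fun φ v => by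
    obtain ⟨n, hn⟩ := hexp φ
    have hzn : eU τ ^ n * eU γ = eU γ * eU τ ^ n := (Commute.zpow_left (show Commute (eU τ) (eU γ) from hτγ') n).eq
    rw [hn, hn, hpγ, ← Equiv.Perm.mul_apply, ← Equiv.Perm.mul_apply, ← latticeGraphPerm_mul, ← latticeGraphPerm_mul, hzn]
  /- the apartment `… L_a — L′_a — L_{a−1} — …` (vertices for ANY valuation-preserving involution: ★ `…_latt_diagonal_zpow_of_v`) -/
  let vL : ℤ → V := fun a => ⟨latt (Matrix.diagonal ![ϖ ^ a, (1 : K), ϖ ^ (-a)]), ⟨0, isSelfDualLattice_latt_diagonal_zpow_of_v hσ hvσ hϖ a⟩⟩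
  let vT : ℤ → V := fun a => ⟨latt (Matrix.diagonal ![ϖ ^ a, (1 : K), ϖ ^ (1 - a)]), ⟨2, isVertexLattice_two_latt_diagonal_zpow_of_v hσ hvσ hϖ a⟩⟩
  have hadjTL : ∀ a : ℤ, (latticeGraph σ ϖ ((StdForm.antidiagonal 3).over K)).Adj (vT a) (vL a) := fun a =>
    latticeGraph_adj_apartment_two_selfDual_of_isVertex hϖ a _ _
  have hadjLT : ∀ a : ℤ, (latticeGraph σ ϖ ((StdForm.antidiagonal 3).over K)).Adj (vL a) (vT (a + 1)) := fun a =>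
    latticeGraph_adj_apartment_selfDual_two_succ_of_isVertex hϖ a _ _
  -- the translation `τ = diag(ϖ⁻¹, 1, σϖ) = diag(ϖ^{−1}, 1, (σϖ)^{−(−1)})` moves the apartment by `c = −1` (★ ED. 2 `_translate_of_isVertex`)
  have hτm' : (((eU τ : ↥(unitaryGroupOfForm σ ((StdForm.antidiagonal 3).over K))) : GL (Fin 3) K) : Matrix (Fin 3) (Fin 3) K) =
      Matrix.diagonal ![ϖ ^ (-1 : ℤ), 1, (σ ϖ) ^ (-(-1 : ℤ))] := by
    rw [hτm, _root_.zpow_neg_one, neg_neg, zpow_one]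
  have hτL : ∀ a : ℤ, τΦ • vL a = vL (a + -1) := fun a =>
    latticeGraphIso_apartment_selfDual_translate_of_isVertex hvσ hϖ0 (eU τ) (-1) a hτm' _ _
  have hτT : ∀ a : ℤ, τΦ • vT a = vT (a + -1) := fun a =>
    latticeGraphIso_apartment_two_translate_of_isVertex hvσ hϖ0 (eU τ) (-1) a hτm' _ _
  have hpowL : ∀ (n a : ℤ), (τΦ ^ n) • vL a = vL (a - n) := fun n => by
    induction n using Int.induction_on with
    | zero => intro a; rw [zpow_zero, one_smul, sub_zero]
    | succ n ih => intro a; rw [_root_.zpow_add_one, mul_smul, hτL, ih, show a + -1 - (n : ℤ) = a - (n + 1) by ring]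
    | pred n ih =>
      intro a
      have h1 : τΦ⁻¹ • vL a = vL (a + 1) := by rw [inv_smul_eq_iff, hτL, show a + 1 + -1 = a by ring]
      rw [_root_.zpow_sub_one, mul_smul, h1, ih, show a + 1 - -(n : ℤ) = a - (-(n : ℤ) - 1) by ring]
  have hpowT : ∀ (n a : ℤ), (τΦ ^ n) • vT a = vT (a - n) := fun n => by
    induction n using Int.induction_on with
    | zero => intro a; rw [zpow_zero, one_smul, sub_zero]
    | succ n ih => intro a; rw [_root_.zpow_add_one, mul_smul, hτT, ih, show a + -1 - (n : ℤ) = a - (n + 1) by ring]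
    | pred n ih =>
      intro a
      have h1 : τΦ⁻¹ • vT a = vT (a + 1) := by rw [inv_smul_eq_iff, hτT, show a + 1 + -1 = a by ring]
      rw [_root_.zpow_sub_one, mul_smul, h1, ih, show a + 1 - -(n : ℤ) = a - (-(n : ℤ) - 1) by ring]
  -- injectivity along the apartment (valuations of the first and third diagonal entries)
  have hnzL : ∀ (a : ℤ) (i : Fin 3), (![ϖ ^ a, (1 : K), ϖ ^ (-a)]) i ≠ 0 := fun a i => by
    fin_cases i
    · exact zpow_ne_zero _ hϖ0
    · exact one_ne_zero
    · exact zpow_ne_zero _ hϖ0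
  have hnzT : ∀ (a : ℤ) (i : Fin 3), (![ϖ ^ a, (1 : K), ϖ ^ (1 - a)]) i ≠ 0 := fun a i => by
    fin_cases i
    · exact zpow_ne_zero _ hϖ0
    · exact one_ne_zero
    · exact zpow_ne_zero _ hϖ0
  have hLinj : ∀ a b : ℤ, vL a = vL b → a = b := fun a b hab => by
    have h := (latt_diagonal_le_latt_diagonal_iff (hnzL a) (hnzL b)).1 (le_of_eq (congrArg Subtype.val hab))
    have h0 := h 0
    have h2 := h 2
    change Valued.v (ϖ ^ a) ≤ Valued.v (ϖ ^ b) at h0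
    change Valued.v (ϖ ^ (-a)) ≤ Valued.v (ϖ ^ (-b)) at h2
    rw [v_zpow_le_v_zpow_iff hϖ] at h0 h2
    omega
  have hTinj : ∀ a b : ℤ, vT a = vT b → a = b := fun a b hab => by
    have h := (latt_diagonal_le_latt_diagonal_iff (hnzT a) (hnzT b)).1 (le_of_eq (congrArg Subtype.val hab))
    have h0 := h 0
    have h2 := h 2
    change Valued.v (ϖ ^ a) ≤ Valued.v (ϖ ^ b) at h0
    change Valued.v (ϖ ^ (1 - a)) ≤ Valued.v (ϖ ^ (1 - b)) at h2
    rw [v_zpow_le_v_zpow_iff hϖ] at h0 h2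
    omega
  have hLT : ∀ a b : ℤ, vL a ≠ vT b := fun a b hab => by
    have h2 : IsVertexLattice σ ϖ ((StdForm.antidiagonal 3).over K) 2 (vL a).1 := by
      rw [congrArg Subtype.val hab]
      exact isVertexLattice_two_latt_diagonal_zpow_of_v hσ hvσ hϖ b
    exact hnot _ h2 (isSelfDualLattice_latt_diagonal_zpow_of_v hσ hvσ hϖ a)
  /- the two-step line `W (2n) = L_{−n}`, `W (2n+1) = L′_{−n}` -/
  have h01 : (latticeGraph σ ϖ ((StdForm.antidiagonal 3).over K)).Adj (vL 0) (vT 0) := (hadjTL 0).symm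
  have h1τ : (latticeGraph σ ϖ ((StdForm.antidiagonal 3).over K)).Adj (vT 0) (τΦ • vL 0) := by
    rw [hτL, show (0 : ℤ) + -1 = -1 by norm_num]
    have h := hadjLT (-1)
    rw [show (-1 : ℤ) + 1 = 0 by norm_num] at h
    exact h.symm
  have hfree₀ : ∀ n : ℤ, τΦ ^ n • vL 0 = vL 0 → n = 0 := fun n hn => by
    rw [hpowL] at hn
    have := hLinj _ _ hn
    omega
  have hfree₁ : ∀ n : ℤ, τΦ ^ n • vT 0 = vT 0 → n = 0 := fun n hn => by
    rw [hpowT] at hn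
    have := hTinj _ _ hn
    omega
  have hne : ∀ n : ℤ, τΦ ^ n • vL 0 ≠ vT 0 := fun n hn => by
    rw [hpowL] at hn
    exact hLT _ _ hn
  obtain ⟨W, hWinj, hWadj, hW, hW0, hW1⟩ := TreeAction.exists_line_of_two_step hadjΦ τΦ (vL 0) (vT 0) h01 h1τ hfree₀ hfree₁ hne
  have hW2 : ∀ n : ℤ, W (n * 2) = vL (-n) := fun n => by
    have h := TreeAction.zpow_smul_line τΦ W hW n 0
    rw [hW0, hpowL, zero_add, zero_sub] at h
    exact h.symm
  have hW2' : ∀ n : ℤ, W (n * 2 + 1) = vT (-n) := fun n => by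
    have h := TreeAction.zpow_smul_line τΦ W hW n 1
    rw [hW1, hpowT, zero_sub, add_comm (1 : ℤ)] at h
    exact h.symm
  -- `γ` shifts the apartment by `c` (★ P2 §1, valuation-only), hence translates the line by `−2c`
  have hγL : ∀ a : ℤ, pγ (vL a) = vL (a + c) := fun a =>
    Subtype.ext (mapGL_latt_apartment_selfDual_of_diagonal hϖ (eU γ) hγm he₀ he₁ he₂ a)
  have hγT : ∀ a : ℤ, pγ (vT a) = vT (a + c) := fun a =>
    Subtype.ext (mapGL_latt_apartment_two_of_diagonal hϖ (eU γ) hγm he₀ he₁ he₂ a)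
  have hγW : ∃ j : ℤ, ∀ k : ℤ, pγ (W k) = W (k + j) := by
    refine ⟨-(2 * c), fun k => ?_⟩
    obtain ⟨n, rfl | rfl⟩ := Int.even_or_odd' k
    · rw [show (2 : ℤ) * n = n * 2 by ring, hW2, hγL, show n * 2 + -(2 * c) = (n - c) * 2 by ring, hW2]
      exact congrArg vL (by ring)
    · rw [show (2 : ℤ) * n + 1 = n * 2 + 1 by ring, hW2', hγT, show n * 2 + 1 + -(2 * c) = (n - c) * 2 + 1 by ring, hW2']
      exact congrArg vT (by ring)
  /- «fixed vertices = pointwise-fixed edges» per period (★ TREE SIDE) -/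
  have hVE := TreeAction.natCard_quotient_fixed_vertices_eq_fixed_edges_of_line_of_exists hT hadjΦ τΦ hgen W hWinj hWadj hW pγ hγadj hγW
  -- the fixed vertices split by type
  have hunion : {v : V | pγ v = v} =
      {v : V | latticeGraphIso σ ϖ ((StdForm.antidiagonal 3).over K) (eU γ) v = v ∧ IsSelfDualLattice σ ϖ ((StdForm.antidiagonal 3).over K) v.1} ∪
        {v : V | latticeGraphIso σ ϖ ((StdForm.antidiagonal 3).over K) (eU γ) v = v ∧ IsVertexLattice σ ϖ ((StdForm.antidiagonal 3).over K) 2 v.1} := by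
    ext v
    simp only [Set.mem_setOf_eq, Set.mem_union]
    constructor
    · intro h
      obtain ⟨d, hvd⟩ := v.2
      rcases type_eq_zero_or_two_of_isVertexLattice_three hvσ hϖ v_det_antidiagonal_three hvd with rfl | rfl
      · exact Or.inl ⟨h, hvd⟩
      · exact Or.inr ⟨h, hvd⟩
    · rintro (⟨h, -⟩ | ⟨h, -⟩) <;> exact h
  have hdisj : Disjoint {v : V | latticeGraphIso σ ϖ ((StdForm.antidiagonal 3).over K) (eU γ) v = v ∧ IsSelfDualLattice σ ϖ ((StdForm.antidiagonal 3).over K) v.1}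
      {v : V | latticeGraphIso σ ϖ ((StdForm.antidiagonal 3).over K) (eU γ) v = v ∧ IsVertexLattice σ ϖ ((StdForm.antidiagonal 3).over K) 2 v.1} :=
    Set.disjoint_left.2 fun v hvA hvB => hnot _ hvB.2 hvA.2
  have hinvA : ∀ (φ : ↥Φ) (v : V), v ∈ {v : V | latticeGraphIso σ ϖ ((StdForm.antidiagonal 3).over K) (eU γ) v = v ∧ IsSelfDualLattice σ ϖ ((StdForm.antidiagonal 3).over K) v.1} →
      φ • v ∈ {v : V | latticeGraphIso σ ϖ ((StdForm.antidiagonal 3).over K) (eU γ) v = v ∧ IsSelfDualLattice σ ϖ ((StdForm.antidiagonal 3).over K) v.1} := fun φ v hv => by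
    refine ⟨?_, (hΦtype φ v 0).2 hv.2⟩
    change pγ (φ • v) = φ • v
    rw [hΦcomm, show pγ v = v from hv.1]
  obtain ⟨-, hsum⟩ := natCard_quotient_orbitRel_comap_union (Φ := ↥Φ) _ _ hdisj hinvA hfinA' hfinB'
  rw [hunion] at hVE
  -- the pointwise-fixed edges are the fixed flags, equivariantly
  have hIE : Nat.card (Quotient ((orbitRel ↥Φ (V × V)).comap
      (Subtype.val : {p : V × V // IsSelfDualLattice σ ϖ ((StdForm.antidiagonal 3).over K) p.1.1 ∧ IsVertexLattice σ ϖ ((StdForm.antidiagonal 3).over K) 2 p.2.1 ∧ p.2.1 < p.1.1 ∧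
        latticeGraphIso σ ϖ ((StdForm.antidiagonal 3).over K) (eU γ) p.1 = p.1 ∧ latticeGraphIso σ ϖ ((StdForm.antidiagonal 3).over K) (eU γ) p.2 = p.2} → V × V))) =
      Nat.card (Quotient ((orbitRel ↥Φ (Set V)).comap
        (Subtype.val : ↥{t : Set V | ∃ a b : V, (latticeGraph σ ϖ ((StdForm.antidiagonal 3).over K)).Adj a b ∧ t = {a, b} ∧ pγ a = a ∧ pγ b = b} → Set V))) := by
    refine (natCard_quotient_orbitRel_comap_eq_of_bijective (Φ := ↥Φ)
      {p : V × V | IsSelfDualLattice σ ϖ ((StdForm.antidiagonal 3).over K) p.1.1 ∧ IsVertexLattice σ ϖ ((StdForm.antidiagonal 3).over K) 2 p.2.1 ∧ p.2.1 < p.1.1 ∧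
        latticeGraphIso σ ϖ ((StdForm.antidiagonal 3).over K) (eU γ) p.1 = p.1 ∧ latticeGraphIso σ ϖ ((StdForm.antidiagonal 3).over K) (eU γ) p.2 = p.2}
      {t : Set V | ∃ a b : V, (latticeGraph σ ϖ ((StdForm.antidiagonal 3).over K)).Adj a b ∧ t = {a, b} ∧ pγ a = a ∧ pγ b = b}
      (fun p => ⟨{(p : V × V).1, (p : V × V).2}, (p : V × V).1, (p : V × V).2, (latticeGraph_adj_iff σ ϖ ((StdForm.antidiagonal 3).over K) _ _).2 (Or.inr p.2.2.2.1), rfl,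
        p.2.2.2.2.1, p.2.2.2.2.2⟩) ⟨?_, ?_⟩ fun q t => ⟨?_, ?_⟩).1
    · intro p q hpq
      have h : ({(p : V × V).1, (p : V × V).2} : Set V) = {(q : V × V).1, (q : V × V).2} := congrArg Subtype.val hpq
      rw [Set.pair_eq_pair_iff] at h
      rcases h with ⟨h1, h2⟩ | ⟨h1, h2⟩
      · exact Subtype.ext (Prod.ext h1 h2)
      · exact (hnot _ (by rw [h1]; exact q.2.2.1) p.2.1).elim
    · rintro ⟨t, a, b, hab, rfl, hγa, hγb⟩
      rw [latticeGraph_adj_iff] at hab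
      obtain ⟨da, ha⟩ := a.2
      obtain ⟨db, hb⟩ := b.2
      rcases hab with hlt | hlt
      · have ht := type_of_lt_three hvσ hϖ v_det_antidiagonal_three ha hb hlt
        rw [ht.1] at ha
        rw [ht.2] at hb
        refine ⟨⟨(b, a), hb, ha, hlt, hγb, hγa⟩, Subtype.ext ?_⟩
        exact Set.pair_comm _ _
      · have ht := type_of_lt_three hvσ hϖ v_det_antidiagonal_three hb ha hlt
        rw [ht.1] at hb
        rw [ht.2] at ha
        exact ⟨⟨(a, b), ha, hb, hlt, hγa, hγb⟩, rfl⟩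
    · rintro ⟨φ, hφ⟩
      refine ⟨φ, ?_⟩
      change φ • ({(t : V × V).1, (t : V × V).2} : Set V) = {(q : V × V).1, (q : V × V).2}
      rw [Set.smul_set_insert, Set.smul_set_singleton, ← Prod.smul_fst, ← Prod.smul_snd, hφ]
    · rintro ⟨φ, hφ⟩
      refine ⟨φ, ?_⟩
      have h : ({φ • (t : V × V).1, φ • (t : V × V).2} : Set V) = {(q : V × V).1, (q : V × V).2} := by
        rw [← Set.smul_set_singleton, ← Set.smul_set_insert]; exact hφ
      rw [Set.pair_eq_pair_iff] at h
      rcases h with ⟨h1, h2⟩ | ⟨h1, -⟩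
      · exact Prod.ext (by rw [Prod.smul_fst, h1]) (by rw [Prod.smul_snd, h2])
      · exact (hnot _ q.2.2.1 (by rw [← h1]; exact (hΦtype φ _ 0).2 t.2.1)).elim
  rw [← hsum, hVE, hIE]

end Transitive

/-! ## §2 The tame ramified place: `σϖ = −ϖ`, `|2| = 1`, `σ` residually trivial, first-order norm surjectivity -/

section Ramified

variable {σ : K →+* K} {ϖ : K}

/-- **KOTTWITZ'S NON-ELLIPTIC RELATION PER PERIOD ON THE `U(3)` TREE AT A TAME RAMIFIED PLACE («P2-RAM»), ON ANY MODEL `eU : G ≃* U(σ, J₀)`.**  The binder block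
`(hσ) (hvσ) (hϖ) (hσϖ : σ ϖ = −ϖ) (hres) (h2 : |2| = 1) (hnorm)` of ★ `isTree_latticeGraph_three_of_neg` VERBATIM (a tamely ramified quadratic extension of non-archimedean local
fields of odd residue characteristic: `σ` the non-trivial automorphism, `ϖ` a uniformiser with `σϖ = −ϖ`); `g₁`, the levels `CA, CB, CI` by membership, `γ` diagonal of valuation
profile `(|ϖ^c|, 1, |ϖ^{−c}|)` and the finiteness binders EXACTLY as in ★ `natCard_quotient_fixedBy_add_eq_natCard_quotient_fixedBy_inf_three`; the one re-lettered binder is the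
translation, `eU τ = diag(ϖ⁻¹, 1, σϖ) (= diag(ϖ⁻¹, 1, −ϖ))` — the unitary generator of the split rank-one torus modulo its compact part at a ramified place (`σ(ϖ⁻¹)·σϖ = 1`;
`diag(ϖ⁻¹, 1, ϖ) ∉ U(σ, J₀)` there).  Conclusion: `#(Fix_γ(G⧸CA)∕τ^ℤ) + #(Fix_γ(G⧸CB)∕τ^ℤ) = #(Fix_γ(G⧸CI)∕τ^ℤ)`, token for token the unramified ★ head's.  PROOF: §1 with
(A) ★ `exists_unitary_mapGL_stdLattice_eq_of_isSelfDualLattice_of_v_two`, (B) ★ `forall_isVertexLattice_two_exists_mapGL_N₁_eq_of_neg`, (I) ★ `forall_flag_exists_unitary_of_v_two`.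
This is the `hN` binder of ★ `RankOneEulerPoincareGlue` (after ★ `classOrbitalIntegral_indicator_complex_eq_mul_natCard_quotient_zpowers`) for Kottwitz's `f_EP^G` of the
quasi-split `U(3)` at a TAME RAMIFIED place; with ★ `natCard_fixedBy_add_eq_natCard_fixedBy_inf_add_one_three_of_neg` («EULER-G-RAM», the `hE` binder there) the EP-G column's
(E)(N) relations now cover every non-split place of odd residue characteristic.
[cite: Kottwitz1988, §2 Theorem 2] [cite: Serre1980Trees, I.6.4 Prop. 24–25; II.1.1] [cite: Laumon1995, Lemma (5.3.2)] [cite: BruhatTits1972, §10] [cite: Tits1979, §2.4, §3.5] -/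
theorem natCard_quotient_fixedBy_add_eq_natCard_quotient_fixedBy_inf_three_of_neg
    (hσ : ∀ x, σ (σ x) = x) (hvσ : ∀ a, Valued.v (σ a) = Valued.v a) (hϖ : Valued.v ϖ = WithZero.exp (-1 : ℤ)) (hσϖ : σ ϖ = -ϖ)
    (hres : ∀ x : K, Valued.v x ≤ 1 → Valued.v (σ x - x) < 1) (h2 : Valued.v (2 : K) = 1)
    (hnorm : ∀ u : K, σ u = u → Valued.v (u - 1) < 1 → ∃ z : K, z * σ z = u ∧ Valued.v (z - 1) ≤ Valued.v (u - 1))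
    (g₁ : GL (Fin 3) K) (hg₁ : (g₁ : Matrix (Fin 3) (Fin 3) K) = Matrix.diagonal ![(1 : K), 1, ϖ])
    {G : Type*} [Group G] (eU : G ≃* ↥(unitaryGroupOfForm σ ((StdForm.antidiagonal 3).over K))) (CA CB CI : Subgroup G)
    (hCA : ∀ g : G, g ∈ CA ↔ ((eU g : ↥(unitaryGroupOfForm σ ((StdForm.antidiagonal 3).over K))) : GL (Fin 3) K) ∈ glInt 3 K)
    (hCB : ∀ g : G, g ∈ CB ↔ ((eU g : ↥(unitaryGroupOfForm σ ((StdForm.antidiagonal 3).over K))) : GL (Fin 3) K) ∈ (glInt 3 K).map (MulAut.conj g₁).toMonoidHom)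
    (hCI : ∀ g : G, g ∈ CI ↔ ((eU g : ↥(unitaryGroupOfForm σ ((StdForm.antidiagonal 3).over K))) : GL (Fin 3) K) ∈ glInt 3 K ∧ ((eU g : ↥(unitaryGroupOfForm σ ((StdForm.antidiagonal 3).over K))) : GL (Fin 3) K) ∈ (glInt 3 K).map (MulAut.conj g₁).toMonoidHom)
    (τ γ : G) (hτm : (((eU τ : ↥(unitaryGroupOfForm σ ((StdForm.antidiagonal 3).over K))) : GL (Fin 3) K) : Matrix (Fin 3) (Fin 3) K) = Matrix.diagonal ![ϖ⁻¹, 1, σ ϖ])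
    {e : Fin 3 → K} (hγm : (((eU γ : ↥(unitaryGroupOfForm σ ((StdForm.antidiagonal 3).over K))) : GL (Fin 3) K) : Matrix (Fin 3) (Fin 3) K) = Matrix.diagonal e) {c : ℤ}
    (he₀ : Valued.v (e 0) = Valued.v (ϖ ^ c)) (he₁ : Valued.v (e 1) = 1) (he₂ : Valued.v (e 2) = Valued.v (ϖ ^ (-c))) (hτγ : τ * γ = γ * τ)
    (hfinA : Finite (Quotient ((orbitRel (Subgroup.zpowers (⟨τ, Subgroup.mem_centralizer_singleton_iff.2 hτγ⟩ : Subgroup.centralizer ({γ} : Set G))) (G ⧸ CA)).comap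
        (Subtype.val : ↥(fixedBy (G ⧸ CA) γ) → G ⧸ CA))))
    (hfinB : Finite (Quotient ((orbitRel (Subgroup.zpowers (⟨τ, Subgroup.mem_centralizer_singleton_iff.2 hτγ⟩ : Subgroup.centralizer ({γ} : Set G))) (G ⧸ CB)).comap
        (Subtype.val : ↥(fixedBy (G ⧸ CB) γ) → G ⧸ CB)))) :
    Nat.card (Quotient ((orbitRel (Subgroup.zpowers (⟨τ, Subgroup.mem_centralizer_singleton_iff.2 hτγ⟩ : Subgroup.centralizer ({γ} : Set G))) (G ⧸ CA)).comap
        (Subtype.val : ↥(fixedBy (G ⧸ CA) γ) → G ⧸ CA))) +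
      Nat.card (Quotient ((orbitRel (Subgroup.zpowers (⟨τ, Subgroup.mem_centralizer_singleton_iff.2 hτγ⟩ : Subgroup.centralizer ({γ} : Set G))) (G ⧸ CB)).comap
        (Subtype.val : ↥(fixedBy (G ⧸ CB) γ) → G ⧸ CB))) =
    Nat.card (Quotient ((orbitRel (Subgroup.zpowers (⟨τ, Subgroup.mem_centralizer_singleton_iff.2 hτγ⟩ : Subgroup.centralizer ({γ} : Set G))) (G ⧸ CI)).comap
        (Subtype.val : ↥(fixedBy (G ⧸ CI) γ) → G ⧸ CI))) := by
  have hN₁ : mapGL g₁ (stdLattice K 3) = latt (Matrix.diagonal ![(1 : K), 1, ϖ]) := by rw [← hg₁]; rfl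
  -- (A), (B), (I) at a tame ramified place (★ `…SelfDualTransitiveTame`, ★ `…TypeTwoTransitiveRamified`, ★ `…EulerRelationRamified`)
  have hA : ∀ M : Submodule (Valued.integer K) (Fin 3 → K), IsSelfDualLattice σ ϖ ((StdForm.antidiagonal 3).over K) M →
      ∃ u : ↥(unitaryGroupOfForm σ ((StdForm.antidiagonal 3).over K)), mapGL (u : GL (Fin 3) K) (stdLattice K 3) = M := fun M hM => by
    obtain ⟨u, hu⟩ := exists_unitary_mapGL_stdLattice_eq_of_isSelfDualLattice_of_v_two hσ hvσ hϖ h2 hM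
    exact ⟨u, hu.symm⟩
  have hB : ∀ M : Submodule (Valued.integer K) (Fin 3 → K), IsVertexLattice σ ϖ ((StdForm.antidiagonal 3).over K) 2 M →
      ∃ u : ↥(unitaryGroupOfForm σ ((StdForm.antidiagonal 3).over K)), mapGL ((u : GL (Fin 3) K) * g₁) (stdLattice K 3) = M := fun M hM => by
    obtain ⟨u, hu⟩ := forall_isVertexLattice_two_exists_mapGL_N₁_eq_of_neg hσ hvσ hϖ hσϖ hres h2 hnorm M hM
    exact ⟨u, by rw [mapGL_mul, hN₁, hu]⟩
  exact natCard_quotient_fixedBy_add_eq_natCard_quotient_fixedBy_inf_three_of_transitive hσ hvσ hϖ g₁ hg₁ hA hB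
    (forall_flag_exists_unitary_of_v_two hσ hvσ hϖ h2 g₁ hg₁) eU CA CB CI hCA hCB hCI τ γ hτm hγm he₀ he₁ he₂ hτγ hfinA hfinB

end Ramified

end Literature.NumberTheory.Automorphic.UnitaryLatticeTree

end
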